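import Summits.BirchSwinnertonDyer.BirchSwinnertonDyer.Theorems.RamifiedSevenEllipticUnitsKummerFrameChart
import Summits.BirchSwinnertonDyer.BirchSwinnertonDyer.Theorems.RamifiedSevenEllipticUnitsKummerChartIndex
import Summits.BirchSwinnertonDyer.BirchSwinnertonDyer.Theorems.RamifiedSevenEllipticUnitsKummerPadicIndex
import Summits.BirchSwinnertonDyer.BirchSwinnertonDyer.Theses.RamifiedSevenEllipticUnits
import Summits.BirchSwinnertonDyer.Rank1Residual.X12.O11.RamifiedRubinFormulaLine
import HarnessLib

/-!
# K7r crux `EllipticUnitValueSeven` (stmt-BirchSwinnertonDyer-19705), line `rubin-formula`: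
# the stub S_dict `stub_localMordellWeilDictSeven` — THE LOCAL MORDELL–WEIL DICTIONARY `m_loc = n + n'`
# IS A THEOREM AT EVERY O11 FRAME (cell `bsd-cm`, seat `bsd-cm-k7r-c3` g6; `--supports` 19705)

HONEST FRAMING. This closes ONE registered stub (S_dict) of the δ line `rubin-formula` on the K7r value
crux; the crux itself (the ramified Rubin formula, stub S_open) stays OPEN, nothing is asserted about it,
and BSD is not proved by any of this — a closed item closes a rung leaf of BirchSwinnertonDyer at most.

STATEMENT (`X12.O11.RamifiedCMLocalMordellWeilDictAt W p`, typed in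
`Rank1Residual/X12/O11/RamifiedRubinFormulaLine.lean`, seat k7r-c3 g5): at every O11 frame
`(K, 𝔭, W', C)` of `(W, p)` and every `ℤ_p`-tower `κ` of `K`, given generators `P`, `P'` of `W(ℚ)`,
`W'(ℚ)` modulo torsion, `W(ℚ_p)[p] = 0 = W'(ℚ_p)[p]`, and exact `p`-adic levels `n`, `n'` of `P`, `P'` in
`W(ℚ_p)`, `W'(ℚ_p)`:  `p^{n+n'} = [E(K_𝔭) ⊗ ℤ_p : tors + loc_𝔭(E(K) ⊗ ℤ_p)]`
(`HasBottomLocalMordellWeilIndexExp W p K 𝔭 κ (n + n')`, [BKNO]-style compact Kummer currency of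
`Literature/…/BurungaleKobayashiNakamuraOta2026/LocalBottomIndex.lean`).

PROOF (`ramifiedCMLocalMordellWeilDictAt_holds`, every prime; the analytic-rank and anticyclotomic
hypotheses of the binder are not used): the bottom layer is `H = Γ_K` (`layerSubgroup_zero`); the index
is computed IN THE CHART `Φ : E(K_𝔭) → ℤ_p × ℤ_p` of `RamifiedSevenEllipticUnitsKummerFrameChart.lean`
(`KummerCore.hasLocalMordellWeilIndexExpOfEmb_top_iff_index`: compact Kummer map, Galois descent,
`E(K_𝔭)[p] = 0` by k7r-c4's `noPTorsion_adicCompletion_of_isFrame`); by (V1)–(V3) of the chart and the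
generator hypotheses the `ℤ_p`-span of `Φ(E(K))` is `λ(P) ℤ_p × λ'(P') ℤ_p`; by the level lemma
(`KummerCore.valuation_eq_of_level`, `λ = Ψ` onto) `v(λ P) = n`, `v(λ' P') = n'`; so the index is
`p^n · p^{n'}` (`KummerCore.index_prod_span_singleton`). Referee G34 countersigned the derivation
(`m_loc = n + n′` PASS, REFEREE-MLOC-COUNTERSIGN-G34.md). Then `stub_localMordellWeilDictSeven` is the case
`p = 7` on 𝒞₇ (the class hypothesis is not needed). References: J. H. Silverman, *AEC* (2009) VII.6.3,
VIII.§1–2, X.5.4, Ex. 10.16; B. Perrin-Riou, Bull. SMF 115 (1987) §0; [BKNO] arXiv:2608.06879 §1.4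
(objects only); cell memo `STUB-PLAN-stub_localMordellWeilDictSeven.md`.
-/

set_option linter.dupNamespace false

noncomputable section

open scoped Classical

open WeierstrassCurve NumberField IsDedekindDomain Field
  Literature.NumberTheory.EllipticCurves Literature.NumberTheory.GaloisRepresentations
  Literature.NumberTheory.EllipticCurves.BurungaleKobayashiNakamuraOta2026
  Summit.BirchSwinnertonDyer.Rank1Residual

namespace Summit.BirchSwinnertonDyer.BirchSwinnertonDyer.Theorems.RamifiedSevenEllipticUnits

/-- **S_dict IS A THEOREM at every prime: `X12.O11.RamifiedCMLocalMordellWeilDictAt W p` holds** for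
every globally minimal `W/ℚ` and every prime `p` (module docstring). [cite: SilvermanAEC2009, Prop. VII.6.3 and Exercise 10.16]
[cite: PerrinRiou1987BSMF, §0 p. 401] -/
theorem ramifiedCMLocalMordellWeilDictAt_holds (W : WeierstrassCurve ℚ) [W.IsElliptic]
    [W.IsGloballyMinimal] (p : ℕ) [Fact p.Prime] : X12.O11.RamifiedCMLocalMordellWeilDictAt W p := by
  intro K _ _ 𝔭 W' _ _ C hF _ κ _ P n P' n' hP hgen htors hdiv hndiv hP' hgen' htors' hdiv' hndiv'
  have hp : p.Prime := Fact.out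
  unfold HasBottomLocalMordellWeilIndexExp
  rw [ZpExtension.layerSubgroup_zero]
  -- the chart at the frame
  obtain ⟨Φ, lam, lam', u, hΦ0, hΦs, hlam0, hlams, hlam'0, hlam's, hu, hV1, hV2, hV3⟩ :=
    KummerCore.exists_frameChart W p hF
  haveI : NoZeroSMulDivisors ℤ_[p] (ℤ_[p] × ℤ_[p]) := KummerCore.noZeroSMulDivisors_prod_padicInt
  haveI : CharZero (𝔭.adicCompletion K) :=
    charZero_of_injective_algebraMap (algebraMap K (𝔭.adicCompletion K)).injective
  have hE := noPTorsion_adicCompletion_of_isFrame W p hF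
  rw [KummerCore.hasLocalMordellWeilIndexExpOfEmb_top_iff_index (W.baseChange K)
    (closureEmb (K := K) (𝔭.adicCompletion K)) p Φ hΦ0 hΦs KummerCore.prod_padicInt_separated hE]
  -- the two generators in the chart and their valuations (the level lemma, `a = 0`)
  have hrange : ∀ z : ℤ_[p], (∃ X, lam X = z) ↔ z ∈ Ideal.span {(p : ℤ_[p]) ^ 0} := fun z ↦ by
    rw [pow_zero, Ideal.span_singleton_one]
    exact ⟨fun _ ↦ Submodule.mem_top, fun _ ↦ hlams z⟩
  have hrange' : ∀ z : ℤ_[p], (∃ X, lam' X = z) ↔ z ∈ Ideal.span {(p : ℤ_[p]) ^ 0} := fun z ↦ by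
    rw [pow_zero, Ideal.span_singleton_one]
    exact ⟨fun _ ↦ Submodule.mem_top, fun _ ↦ hlam's z⟩
  obtain ⟨hx₁, hv₁⟩ := KummerCore.valuation_eq_of_level lam hlam0 hrange htors hdiv hndiv
  obtain ⟨hx₂, hv₂⟩ := KummerCore.valuation_eq_of_level lam' hlam'0 hrange' htors' hdiv' hndiv'
  rw [zero_add] at hv₁ hv₂
  -- torsion goes to torsion under `E(ℚ) → E(ℚ_p)`
  have htorsP : ∀ T : W.toAffine.Point, IsOfFinAddOrder T → IsOfFinAddOrder (W.toPadicPoint p T) :=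
    fun T hT ↦ (W.toPadicPoint p).isOfFinAddOrder hT
  have htorsP' : ∀ T : W'.toAffine.Point, IsOfFinAddOrder T → IsOfFinAddOrder (W'.toPadicPoint p T) :=
    fun T hT ↦ (W'.toPadicPoint p).isOfFinAddOrder hT
  -- the `ℤ_p`-span of `Φ(E(K))` is `λ(P) ℤ_p × λ'(P') ℤ_p`
  have hZ : Submodule.span ℤ_[p] (Φ '' Set.range
      (Affine.Point.baseChange (W' := W.baseChange K) K (𝔭.adicCompletion K))) =
      Submodule.prod (Ideal.span {lam (W.toPadicPoint p P)}) (Ideal.span {lam' (W'.toPadicPoint p P')}) := by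
    apply le_antisymm
    · rw [Submodule.span_le]
      rintro _ ⟨_, ⟨R, rfl⟩, rfl⟩
      obtain ⟨Q, Q', hQQ'⟩ := hV3 R
      obtain ⟨k, T, hT, hQ⟩ := hgen Q
      obtain ⟨k', T', hT', hQ'⟩ := hgen' Q'
      rw [SetLike.mem_coe, hQQ', hQ, hQ']
      simp only [map_add, map_zsmul, (hlam0 _).2 (htorsP T hT), (hlam'0 _).2 (htorsP' T' hT'), add_zero,
        Submodule.mem_prod, zsmul_eq_mul]
      exact ⟨Ideal.mem_span_singleton'.2 ⟨u * k, by ring⟩, Ideal.mem_span_singleton'.2 ⟨u * k', by ring⟩⟩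
    · rintro ⟨a, b⟩ hab
      rw [Submodule.mem_prod] at hab
      obtain ⟨c₁, hc₁⟩ := Ideal.mem_span_singleton'.1 hab.1
      obtain ⟨c₂, hc₂⟩ := Ideal.mem_span_singleton'.1 hab.2
      obtain ⟨T₂, hT₂⟩ := hV2 P'
      have h1 : ((lam (W.toPadicPoint p P), (0 : ℤ_[p])) : ℤ_[p] × ℤ_[p]) ∈ Submodule.span ℤ_[p]
          (Φ '' Set.range (Affine.Point.baseChange (W' := W.baseChange K) K (𝔭.adicCompletion K))) :=
        Submodule.subset_span ⟨_, ⟨_, rfl⟩, hV1 P⟩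
      have h2 : (((0 : ℤ_[p]), lam' (W'.toPadicPoint p P')) : ℤ_[p] × ℤ_[p]) ∈ Submodule.span ℤ_[p]
          (Φ '' Set.range (Affine.Point.baseChange (W' := W.baseChange K) K (𝔭.adicCompletion K))) :=
        Submodule.subset_span ⟨_, ⟨_, rfl⟩, hT₂⟩
      have hsum : ((a, b) : ℤ_[p] × ℤ_[p]) =
          c₁ • ((lam (W.toPadicPoint p P), (0 : ℤ_[p])) : ℤ_[p] × ℤ_[p]) +
            c₂ • (((0 : ℤ_[p]), lam' (W'.toPadicPoint p P')) : ℤ_[p] × ℤ_[p]) := by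
        refine Prod.ext ?_ ?_
        · simpa using hc₁.symm
        · simpa using hc₂.symm
      rw [hsum]
      exact Submodule.add_mem _ (Submodule.smul_mem _ c₁ h1) (Submodule.smul_mem _ c₂ h2)
  rw [hZ, KummerCore.index_prod_span_singleton hx₁ hx₂, hv₁, hv₂]

/-- **stub S_dict** of the line `rubin-formula` on crux `EllipticUnitValueSeven`
(stmt-BirchSwinnertonDyer-19705): the local Mordell–Weil dictionary `m_loc = n + n'` at the ramified
prime `7` for every globally minimal `W ∈ 𝒞₇` — PROVED (the case `p = 7` of
`ramifiedCMLocalMordellWeilDictAt_holds`; the class hypothesis is not needed). Closes no item by itself;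
BSD is not claimed. [cite: SilvermanAEC2009, Prop. VII.6.3 and Exercise 10.16] -/
theorem stub_localMordellWeilDictSeven :
    ∀ (W : WeierstrassCurve ℚ) [W.IsElliptic] [W.IsGloballyMinimal] [Fact (Nat.Prime 7)],
      X12.ClassCSeven W → X12.O11.RamifiedCMLocalMordellWeilDictAt W 7 :=
  fun W _ _ _ _ ↦ ramifiedCMLocalMordellWeilDictAt_holds W 7

end Summit.BirchSwinnertonDyer.BirchSwinnertonDyer.Theorems.RamifiedSevenEllipticUnits

end
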